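import Summits.QuantumFields.YangMills.Theorems.BalabanUVNodesN09NestingOfHierAxialAtRecordAx
import Summits.QuantumFields.YangMills.Theorems.BalabanUVNodesN11GaussianCertificateDefsChi
import Summits.QuantumFields.YangMills.Theorems.UnitScaleTiltMinimiserStabilityRegPrAvgActionDefect
import Literature.MathematicalPhysics.QuantumFieldTheory.Balaban1983to89.Node00.Record13NumericsOfThm1CCMWZBChi
import Literature.MathematicalPhysics.QuantumFieldTheory.Balaban1983to89.Node00.Record12NumericsFamilyDict

/-!
# NODE N24 (B2) — N09's Ax DOOR AT THE GAUSS PIN OF THE WINDOWED COLLARED z-WITNESS: THE SEVEN NUMERIC ROWS PAID FROM THE ENGINE'S LETTERS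
# (helper for the LINE-2′ engine editions «N09T-Ax» ✓p814289∕✓p814863 → «N09T7»; ref-Q g15 READ #267 ADVISORY «the 7 numeric rows are payable at Θ»; g23's Ax door v2 ✓p812325 §5)
# CLASS-S prose edition ′ of ✓p816166 (ref-Q READ #268 NIT-4 folded: the δ₂ locator re-keyed to [I] (0.4)–(0.9); statement and proof byte-identical)

TRACK A (YM-PLAN §2d, node N24 of 28 = binder B2, COMPOSITE), seat `pub-ymgap-dag-n24-c` (gen 24; the -a hand on K1ᴬ stmt-QuantumFields-27239 LINE 2′, v11.1 1c0150ff21ca0f8d;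
`--supports stmt-QuantumFields-27239 --as helper`, count-neutral).  [I] = [Balaban1987RG1]; [B11] = [Balaban1985Variational]; [B12] = [Balaban1985RegularSpaces] ∕ [I] §1 (Prop. 7 (1.145) p.100 = the regular-space inclusion behind `hres` ∕ `huniq`); δ_N = min(1∕3, π∕N) = the tree's `ExpMeanLog.deltaSU` ([I] (0.4)–(0.9) pp.252–253), δ₂ = 1∕3.

WHAT THIS FILE IS.  ONE bookkeeping theorem.  g23's Ax door v2 `…N09NestingOfHierAxialAtRecordAx.h09T_recordAx_of_hierAxial_of_reg8_of_suppPt` takes FOURTEEN located rows at a Stage-13 `H`-tuple `θ` and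
returns N09's Theorem-3 member (`∃ γ₉ > 0, ∀ w` on the re-centred datum, `w.γ ≤ γ₉ → ∀ P, smallCouplings → smallFieldInductive`, `γ₉ := 1`).  Seven of the rows are NUMERIC (`hle` εreg ≤ εbg,
`hεreg` 0 ≤ εreg, `hεχ` 0 < ε₂₉, `hε` 0 < εbg, `hε3` 143·((d+4)²∕4)²·εbg ≤ 1∕3, `hε2` 2εbg ≤ 2δ₂∕((d+4)L)², `hε₀` 2εbg ≤ ε₀L²).  AT THE WITNESS OF RECORD of the K1ᴬ LINE-2′ engine — the Ax Gauss
pin `θN = gaussPinH (Stage13HParams.ofHistoryBlind F 2 ⟨theta13OfThm1CCMWZBAx F 2 j γ a₀ ε₀ ε₂₉ B₃ B₉ a₀ a₁' Efl logz, Zr⟩) χ` of def-Y's re-centred windowed collared z-witness, for ANY volume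
slot `Efl`, log-slot `logz`, run-indexed residual `Zr` and cut-off slot `χ` — those seven rows are PAID from the engine's three letters `0 < a₀ ≤ 1∕(109824·L²)` (the radius ceiling), `ε₀ = a₀`
(edition «N09T5»'s threshold), `0 < ε₂₉`: the pin's faces `θN.εbg = a₀`, `θN.ν.εreg = a₀`, `θN.ν.ε₀ = ε₀`, `θN.ε₂₉ = ε₂₉` are `rfl`; `(F.P K).d = 4`, `(F.P K).L = F.L`; `8 ≤ L`; `δ_{SU(2)} = 1∕3`
(`AvgActionDefect.deltaSU_fin_two`); `143·(8²∕4)² = 36 608 = 109 824∕3`, so the ceiling pays `hε3` EXACTLY; `128·a₀L² ≤ 128∕109 824 ≤ 2∕3` pays `hε2`; `2a₀ ≤ 64a₀ ≤ a₀L²` pays `hε₀`.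
The theorem is stated at an abstract `θN` pinned by `hθ : θN = …`, so that a caller whose seven ANALYTIC rows are displayed at `θN = Θ →` (the engine's `h09RF … hP _ rfl`) consumes them verbatim
and stays inside the default heartbeat budget (the fourteen-row application with the numerics proved in-line inside the 300-line engine proof does not).

HONEST FRAMING.  Bookkeeping at green homes; NO estimate of Bałaban's proved here: the seven ANALYTIC rows ([B11] Thm 1 regularity on the domains `hreg8`, hierarchical axiality `haxbg`, the
re-centred cut-off's support property `hχregpt`, integrability `hint`, [B12]'s minimiser rows `h11` ∕ `hres` ∕ `huniq`) stay HYPOTHESES; N09 NOT discharged; no registered stub closed; K0ᴬ ∕ K1ᴬ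
(DECIDING) ∕ K3ᴬ OPEN (K1ᴬ v11.1 0∕6); counts UNMOVED (discharged 8∕27 · K 1∕4); one finite 𝕋⁴ programme at fixed ε, Bałaban AS PRINTED; R4 = the conditional finite-𝕋⁴ rung `BalabanLadder.UV`
only; NOT continuum ∕ ℝ⁴ ∕ OS; NOT the Yang–Mills mass gap (Clay).  No `sorry`, `def`, `instance`, `notation`.
References (bookkeeping only): [Balaban1987RG1] Thm 3 p.264, (1.20)–(1.22) p.264, §1 pp.263–264, (0.4)–(0.9) pp.252–253, (0.21) p.256, (1.2) p.260; [Balaban1985Variational] Thm 1 (6), (8)–(10) p.279;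
[Balaban1985RegularSpaces] Prop. 7 (1.145) p.100 (the `hres` ∕ `huniq` rows); [Balaban1988Convergent] (2.4) p.255, (3.16)–(3.20) pp.268–269.
-/

noncomputable section

namespace Summit.QuantumFields.YangMills.BalabanUVNodes.N24N09AxDoorNumericRows7PaidAtGaussPinThm1CCMWZBAx

open MeasureTheory
open Literature.MathematicalPhysics.QuantumFieldTheory.Balaban1983to89
open Literature.MathematicalPhysics.QuantumFieldTheory.Balaban1983to89.T4Continuum
open Literature.MathematicalPhysics.QuantumFieldTheory.Balaban1983to89.DagBinding (WorldP leavesP)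
open Literature.MathematicalPhysics.QuantumFieldTheory.Balaban1983to89.Node00
open Literature.MathematicalPhysics.QuantumFieldTheory.Balaban1983to89.ExpMeanLog (deltaSU)
open Summit.QuantumFields.YangMills.Theorems.BalabanUVNodesN11GaussianCertificateDefsChi (gaussPinH)
open Summit.QuantumFields.YangMills.BalabanUVNodes.N09NestingOfHierAxialAtRecordAx (h09T_recordAx_of_hierAxial_of_reg8_of_suppPt)
open Summit.QuantumFields.YangMills.Theorems (AvgActionDefect.deltaSU_fin_two)

variable {F : T4Family}

/-- **§0 ★ N09's Ax DOOR AT THE GAUSS PIN OF THE WINDOWED COLLARED z-WITNESS, SEVEN NUMERIC ROWS PAID** (edition «N09T7»; ref-Q g15 READ #267 ADVISORY «7 numeric rows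
payable at Θ»).  At `θN = gaussPinH (Stage13HParams.ofHistoryBlind F 2 ⟨theta13OfThm1CCMWZBAx F 2 j γ a₀ ε₀ ε₂₉ B₃ B₉ a₀ a₁' Efl logz, Zr⟩) χ` (ANY `Efl`, `logz`, residual `Zr`, cut-off slot `χ`)
g23's Ax door v2 `…N09NestingOfHierAxialAtRecordAx.h09T_recordAx_of_hierAxial_of_reg8_of_suppPt` (✓p812325 §5, `γ₉ := 1`) needs only its seven ANALYTIC located rows — [B11] Thm 1 regularity
on the domains `hreg8`, hierarchical axiality of the background `haxbg`, the re-centred cut-off's support property `hχregpt`, integrability `hint`, [B12]'s minimiser rows `h11` ∕ `hres` ∕ `huniq` —: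
its seven NUMERIC rows are paid HERE from the engine's letters `0 < a₀ ≤ 1∕(109824·L²)`, `ε₀ = a₀`, `0 < ε₂₉`.  The pin's faces `θN.εbg = a₀`, `θN.ν.εreg = a₀`, `θN.ν.ε₀ = ε₀`, `θN.ε₂₉ = ε₂₉` are `rfl`
(`gaussPinH` and `Stage13HParams.ofHistoryBlind` keep `toStage13Params`; `theta13OfThm1CCMWZBAx_εbg ∕ _εreg`, `numerics7OfThm1CCM_ε₀`); `(F.P K).d = 4`, `(F.P K).L = F.L` (`T4Family.P_d ∕ P_L`), `8 ≤ L`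
(`eight_le_L_stage3OfFamily`), `δ_{SU(2)} = 1∕3` (`AvgActionDefect.deltaSU_fin_two`; the tree's `ExpMeanLog.deltaSU` at `N = 2`, [I] (0.4)–(0.9) pp.252–253): `hle : a₀ ≤ a₀`, `hεreg : 0 ≤ a₀`, `hεχ : 0 < ε₂₉`, `hε : 0 < a₀`,
`hε3 : 143·((4+4)²∕4)²·a₀ = 36 608·a₀ ≤ 1∕3` (the engine's ceiling pays it EXACTLY: `109 824 = 3·36 608`), `hε2 : 2a₀ ≤ (2∕3)∕(8L)²` (`128·a₀L² ≤ 128∕109 824`), `hε₀ : 2a₀ ≤ ε₀·L² = a₀L²` (`64 ≤ L²`).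
Stated at an abstract `θN` pinned by `hθ`, so that a caller's rows displayed at `θN = Θ →` are consumed verbatim (`… hP rfl …`) and the caller stays inside the default heartbeat budget.
Bookkeeping only; nothing of Bałaban asserted (the seven analytic rows ARE [B11] Thm 1 ∕ [B12] §1 content, displayed).
[cite: Balaban1987RG1, Thm 3 p.264, (1.20)–(1.22) p.264, §1 pp.263–264, (0.4)–(0.9) pp.252–253, (0.21) p.256, (1.2) p.260; Balaban1985Variational, Thm 1 (6), (8)–(10) p.279; Balaban1985RegularSpaces, Prop. 7 (1.145) p.100 (bookkeeping, the `hres` ∕ `huniq` rows); Balaban1988Convergent, (2.4) p.255, (3.16)–(3.20) pp.268–269 (bookkeeping)] -/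
theorem N24_h09T_recordAx_at_gaussPinH_theta13OfThm1CCMWZBAx_of_analyticRows7 {j : ℕ} {γ ε₀ ε₂₉ B₃ B₉ a₀ a₁' : ℝ} {Efl logz : B12.RunParams → ℕ → ℝ}
    {Zr : (p : B12.RunParams) → TkResidualW F 2 (FluctV 2) p.K} {χ : ChiSlot F 2} {θN : Stage13HParams F 2} (h : θN.Provisos₁₃SepCoPHAx F 2)
    (hθ : θN = gaussPinH (Stage13HParams.ofHistoryBlind F 2 ⟨theta13OfThm1CCMWZBAx F 2 j γ a₀ ε₀ ε₂₉ B₃ B₉ a₀ a₁' Efl logz, Zr⟩) χ)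
    (ha₀ : 0 < a₀) (ha₀ρ : a₀ ≤ 1 / (109824 * (F.L : ℝ) ^ 2)) (hε₀def : ε₀ = a₀) (hε' : 0 < ε₂₉)
    (hreg8 : ∀ (P : B12.RunParams) (k : ℕ), k ≤ P.K → ∀ V ∈ domAltOfRecord F 2 θN.ν P.K k, Uk F 2 P.K k θN.εbg V ∈ bgReg F 2 P.K k θN.ν.εreg)
    (haxbg : ∀ (P : B12.RunParams) (k : ℕ), k ≤ P.K → ∀ V ∈ domAltOfRecord F 2 θN.ν P.K k, ∀ j < k,
      AxialGauge (contourOfRecord F 2 P.K j) (Averaging.iter (avOfRecord F 2 P.K) j (Uk F 2 P.K k θN.εbg V)))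
    (hχregpt : ∀ (P : B12.RunParams) (i : ℕ), i + 1 < P.K → ∀ U : GaugeField (F.P P.K) (i + 1) (SU 2),
      (avOfRecord F 2 P.K (i + 1)).avg U ∈ domAltOfRecord F 2 θN.ν P.K (i + 2) →
        U ∉ regSetOfRecord F 2 P.K i (betaInputOfRecord F 2 (TβOfRecord₁₃ F 2) (chiβOfRecord₁₃Ax F 2 θN.toStage13Params) P.K (gOfRecord₁₃Ax F 2 θN.toStage13Params P) i) ∩
            domAltOfRecord F 2 θN.ν P.K (i + 1) →
          chiβOfRecord₁₃Ax F 2 θN.toStage13Params P.K (gOfRecord₁₃Ax F 2 θN.toStage13Params P) (i + 1) U = 0)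
    (hint : ∀ (P : B12.RunParams), ∀ j < P.K, Integrable (betaInputOfRecord F 2 (TβOfRecord₁₃ F 2) (chiβOfRecord₁₃Ax F 2 θN.toStage13Params) P.K
      (gOfRecord₁₃Ax F 2 θN.toStage13Params P) j) (fieldMeasure (F.P P.K) j (SU 2)))
    (h11 : ∀ (P : B12.RunParams) (k : ℕ), k ≤ P.K → ∀ V ∈ domAltOfRecord F 2 θN.ν P.K k, UkExists F 2 P.K k θN.εbg V ∧ UniqueUkOrbit F 2 P.K k θN.εbg V)
    (hres : ∀ (P : B12.RunParams) (k : ℕ), k ≤ P.K → HRestrict F 2 θN.εbg P.K k (domAltOfRecord F 2 θN.ν P.K k))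
    (huniq : ∀ (P : B12.RunParams) (k : ℕ), k ≤ P.K → ∀ V ∈ domAltOfRecord F 2 θN.ν P.K k, ∀ j < k,
      UniqueUkOrbit F 2 P.K (j + 1) θN.εbg (Averaging.iter (avOfRecord F 2 P.K) (j + 1) (Uk F 2 P.K k θN.εbg V))) :
    ∃ γ₉ : ℝ, 0 < γ₉ ∧ ∀ w : WorldP, w.C = (datumOfRecord₁₃SepCoPHAx F 2 θN h).C → w.γ ≤ γ₉ →
      ∀ P : B12.RunParams, (leavesP w P).smallCouplings → (leavesP w P).smallFieldInductive := by
  subst hθ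
  -- `8 ≤ L`, the ceiling's consequences `a₀ ≤ 1∕109 824`, `a₀·L² ≤ 1∕109 824`
  have hL8 : (8 : ℝ) ≤ (F.L : ℝ) := by
    have h1 := eight_le_L_stage3OfFamily F
    have h2 := stage3OfFamily_ℓ₆_succ F
    exact_mod_cast (show (8 : ℕ) ≤ F.L by omega)
  have hL0 : (0 : ℝ) < (F.L : ℝ) := by linarith
  have hL2 : (0 : ℝ) < 109824 * (F.L : ℝ) ^ 2 := by positivity
  have ha₀small : a₀ ≤ 1 / 109824 := ha₀ρ.trans (by
    rw [one_div_le_one_div hL2 (by norm_num)]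
    nlinarith [hL8])
  have ha₀L : a₀ * (F.L : ℝ) ^ 2 ≤ 1 / 109824 := by
    have h := (le_div_iff₀ hL2).1 ha₀ρ
    nlinarith [h]
  -- the pin's four faces (`rfl`)
  have fbg : (gaussPinH (Stage13HParams.ofHistoryBlind F 2 ⟨theta13OfThm1CCMWZBAx F 2 j γ a₀ ε₀ ε₂₉ B₃ B₉ a₀ a₁' Efl logz, Zr⟩) χ).εbg = a₀ := rfl
  have freg : (gaussPinH (Stage13HParams.ofHistoryBlind F 2 ⟨theta13OfThm1CCMWZBAx F 2 j γ a₀ ε₀ ε₂₉ B₃ B₉ a₀ a₁' Efl logz, Zr⟩) χ).ν.εreg = a₀ := rfl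
  have fε₀ : (gaussPinH (Stage13HParams.ofHistoryBlind F 2 ⟨theta13OfThm1CCMWZBAx F 2 j γ a₀ ε₀ ε₂₉ B₃ B₉ a₀ a₁' Efl logz, Zr⟩) χ).ν.ε₀ = ε₀ := rfl
  have f29 : (gaussPinH (Stage13HParams.ofHistoryBlind F 2 ⟨theta13OfThm1CCMWZBAx F 2 j γ a₀ ε₀ ε₂₉ B₃ B₉ a₀ a₁' Efl logz, Zr⟩) χ).ε₂₉ = ε₂₉ := rfl
  refine h09T_recordAx_of_hierAxial_of_reg8_of_suppPt _ h hreg8 (freg.trans fbg.symm).le ?_ haxbg hχregpt hint h11 hres huniq ?_ ?_ ?_ ?_ ?_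
  · rw [freg]; exact ha₀.le
  · rw [f29]; exact hε'
  · rw [fbg]; exact ha₀
  · -- `hε3`: `143·16²·a₀ = 36 608·a₀ ≤ 1∕3`
    intro P; rw [fbg, T4Family.P_d]; norm_num; nlinarith [ha₀small]
  · -- `hε2`: `2a₀·(8L)² = 128·a₀L² ≤ 2∕3`
    intro P
    have hnat : ((((F.P P.K).d + 4) * (F.P P.K).L : ℕ) : ℝ) = 8 * (F.L : ℝ) := by rw [T4Family.P_d, T4Family.P_L]; push_cast; ring
    rw [fbg, hnat, AvgActionDefect.deltaSU_fin_two, le_div_iff₀ (pow_pos (mul_pos (by norm_num) hL0) 2)]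
    have h128 : 2 * a₀ * (8 * (F.L : ℝ)) ^ 2 = 128 * (a₀ * (F.L : ℝ) ^ 2) := by ring
    rw [h128]; linarith [ha₀L]
  · -- `hε₀`: `2a₀ ≤ 64a₀ ≤ a₀L²`
    intro P
    rw [fbg, fε₀, T4Family.P_L, hε₀def]
    have h64 : a₀ * 64 ≤ a₀ * (F.L : ℝ) ^ 2 := mul_le_mul_of_nonneg_left (by nlinarith [hL8]) ha₀.le
    linarith [h64]

end Summit.QuantumFields.YangMills.BalabanUVNodes.N24N09AxDoorNumericRows7PaidAtGaussPinThm1CCMWZBAx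

end
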